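import Summits.ABC.ABC.Theses.DefiniteXi
import Literature.NumberTheory.EllipticCurves.OpenImageMazurAssemblyProofs
import Literature.NumberTheory.EllipticCurves.OpenImageMazurInertiaThreeProofs
import Literature.NumberTheory.EllipticCurves.OpenImageMazurTwistProofs
import Literature.NumberTheory.EllipticCurves.CyclicIsogenyCharacterFrobeniusProofs
import Literature.NumberTheory.EllipticCurves.RationalIsogenyFrobeniusCriterionPrimePower
import Literature.NumberTheory.EllipticCurves.RationalIsogenyDegreesProofs
import Literature.NumberTheory.EllipticCurves.OrdinaryReductionTorsionCharactersProofs
import Literature.NumberTheory.EllipticCurves.OrdinaryReductionUnramifiedCharacterProofs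
import Literature.NumberTheory.EllipticCurves.TateCurve.NumberFieldUniformizationTwisted
import Literature.NumberTheory.EllipticCurves.QuadraticTwistTateFormProofs
import HarnessLib

/-!
# Stub-ideation k=2 (gen 3, FAMILY 2 — RESHAPE) for `stub_pasten163` — crux `DefiniteRTControlPrime`

Companion to `STUB-IDEAS-stub_pasten163-2.md` (gen 3).  Scratch check that the helper statements
elaborate; every `sorry` is a HELPER for the stub prover; the two `sorry`-free items (`U1`, `C1`)
are the cheap arithmetic ends of the chain.

Plan A (verbatim stub `PastenShimura2024_minimalDegree_le_163_mul`) = import by name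
(`Summit.ABC.ABC.Theorems.mazurKenkuBound_of_radiusItem`, or
`PastenShimura2024_minimalDegree_le_163_mul_of_mazurKenku'`); `163` is attained (CM by `−163`),
so no Mazur-free proof of the verbatim constant exists (`PastenShimura2024_minimalDegree_le_163_mul_iff`).

Plan B (RESHAPE — uses the idle `C·N^ε` of the crux): replace `163` by the cyclic-isogeny
DIAMETER of the Frey class, proved Mazur–Kenku-free.  Gen 2 (all three ideators) did this through a
SPLIT middle curve (`ℓ^{2k} ∣ d ⇒` a curve of the class with `E[ℓᵏ] = A ⊕ B` stable) — costing the
middle-curve construction (k1 H6 / k3 C1), a global unipotent Tate BASIS at every multiplicative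
`v ∤ ℓ` (k2 L1/L1′, k3 C2a), and the finite-group lemmas A2/A3.  THIS CUT removes the split:

* work with the ORIGINAL kernel line `ℤP ⊂ W[ℓᵏ]` (`ℓ` odd, `P` of order `ℓᵏ`, character
  `r : Γ_ℚ → (ℤ/ℓᵏ)ˣ`) and HALVE THE MODULUS: `r̄ := r mod ℓ^⌈k/2⌉`;
* (U) at a multiplicative `v ∤ ℓ` the tree's `smul_smul_sub_eq_of_mem_inertia_geomPoints`
  (`(τ−1)²P = 0`, no basis) gives `(r(τ)−1)² ≡ 0 (ℓᵏ)`, i.e. `r̄(τ) = 1` EXACTLY (U1, U2);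
* (D) at `v = ℓ` a FILTRATION DICHOTOMY (D1, pure algebra on one subgroup `E₁ ≤ W[ℓᵏ]`, no basis):
  fed by the PROVED Greenberg facts (ordinary, D2) / the PROVED twisted Tate uniformisation
  (multiplicative, D3), it pins `r|I_ℓ ∈ {y, x}` exactly, whence `(r·χ^{-ε})² = 1` on `I_ℓ` (D5);
* (T) at `2`: `r¹² = 1` (`v₂(j) ≥ 0`, tree `pow_twelve…`, T1 PROVED below modulo the tree) or
  `r̄² = 1` (`v₂(j) < 0`: signed twist + (U), T2);
* (M) Minkowski `monoidHom_eq_one_of_forall_inertia` ⇒ `r̄ = b·χ^ε`, `b¹² = 1` (G1);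
* (F) tree Frobenius congruence + gen-2 k2 A1 ⇒ `ℓ^⌈k/2⌉ ∣ n₁₂(p) = p¹² + 1 − s₁₂(a_p,p)` (H5);
* (C) `d_odd ∣ (n₁₂(p₀)·n₁₂(p₁))²` (C1 PROVED), `2`-part `≤ 16` (landed
  `isogeny_isCyclic_degree_ne_thirtyTwo`), `n₁₂(p) ≤ (p⁶+1)²`, `p₀,p₁ ≪_δ N^δ` (k1 H7/H8)
  ⇒ k1's `FreyIsogenyDiameter` ⇒ k1's `definiteRTControlPrime_of_diameter`.
-/

namespace Summit.ABC.ABC.Cruxes.DefiniteRTControlPrime.Sketch.Ideas2g3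

open Literature.NumberTheory.EllipticCurves Literature.NumberTheory.GaloisRepresentations
open WeierstrassCurve IsDedekindDomain NumberField Field

/-- `⌈k/2⌉`, the halved exponent. -/
def halfCeil (k : ℕ) : ℕ := (k + 1) / 2

theorem halfCeil_le (k : ℕ) : halfCeil k ≤ k := by unfold halfCeil; omega

theorem le_two_mul_halfCeil (k : ℕ) : k ≤ 2 * halfCeil k := by unfold halfCeil; omega

theorem pow_halfCeil_dvd (ℓ k : ℕ) : ℓ ^ halfCeil k ∣ ℓ ^ k := pow_dvd_pow ℓ (halfCeil_le k)

/-! ## U — unipotence on ONE line, at half level (replaces gen-2 L1/L1′/A2, k3 C2a/C2a′) -/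

/-- U1 (pure arithmetic, PROVED): `(s−1)²·P = 0` for `P` of order `ℓᵏ` forces `ℓ^⌈k/2⌉ ∣ s − 1`. -/
theorem pow_halfCeil_dvd_of_sq_smul_eq_zero {M : Type*} [AddCommGroup M] {ℓ k : ℕ} (hℓ : ℓ.Prime)
    {P : M} (hP : addOrderOf P = ℓ ^ k) {s : ℤ} (hs : ((s - 1) ^ 2) • P = 0) :
    (ℓ : ℤ) ^ halfCeil k ∣ s - 1 := by
  haveI := Fact.mk hℓ
  have h1 : ((ℓ : ℤ) ^ k) ∣ (s - 1) ^ 2 := by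
    have := addOrderOf_dvd_iff_zsmul_eq_zero.mpr hs
    rw [hP] at this
    exact_mod_cast this
  rcases eq_or_ne (s - 1) 0 with h0 | h0
  · rw [h0]; exact dvd_zero _
  rw [padicValInt_dvd_iff] at h1 ⊢
  refine Or.inr ?_
  rcases h1 with h1 | h1
  · exact absurd (pow_eq_zero_iff two_ne_zero |>.mp h1) h0
  · rw [pow_two, padicValInt.mul h0 h0] at h1
    unfold halfCeil
    omega

/-- U2 (one cycle): at a multiplicative place `v ∤ ℓ` the character of a stable cyclic line of
order `ℓᵏ` is trivial MODULO `ℓ^⌈k/2⌉` on inertia.  Proof: the tree's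
`WeierstrassCurve.smul_smul_sub_eq_of_mem_inertia_geomPoints` gives `τ(τP − P) = τP − P`, i.e.
`((r τ).val − 1)²·P = 0`; U1; `ZMod.unitsMap`/`castHom` bookkeeping. -/
theorem unitsMap_cyclicCharacter_eq_one_of_hasMultiplicativeReductionAt (W : WeierstrassCurve ℚ)
    [W.IsElliptic] {v : HeightOneSpectrum (𝓞 ℚ)} (hv : W.HasMultiplicativeReductionAt v)
    {ℓ k : ℕ} [Fact ℓ.Prime] (hℓv : (ℓ : 𝓞 ℚ) ∉ v.asIdeal) (hk : 1 ≤ k)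
    {P : geomPoints W} (hP : addOrderOf P = ℓ ^ k)
    {r : absoluteGaloisGroup ℚ →* (ZMod (ℓ ^ k))ˣ}
    (hr : ∀ σ : absoluteGaloisGroup ℚ, σ • P = ((r σ : (ZMod (ℓ ^ k))ˣ) : ZMod (ℓ ^ k)).val • P)
    {𝔓 : Ideal (absIntegers (𝓞 ℚ) ℚ)} (h𝔓 : 𝔓 ∈ v.primesAbove)
    {τ : absoluteGaloisGroup ℚ} (hτ : τ ∈ 𝔓.inertia (absoluteGaloisGroup ℚ)) :
    ZMod.unitsMap (pow_halfCeil_dvd ℓ k) (r τ) = 1 := by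
  sorry

/-! ## T — the place `2` (`ℓᵏ` odd), on ONE line -/

/-- T1 (PROVED modulo the tree): `j` integral at a place `v ∤ 3m` ⇒ `r(τ)¹² = 1` on inertia at `v`
(`Mazur1978.pow_twelve_smul_eq_of_mem_inertia_of_valuation_j_le_one_of_three` +
`Mazur1978.eq_one_of_val_smul_eq_of_addOrderOf`).  Used at `v = 2`, `m = ℓᵏ`. -/
theorem cyclicCharacter_pow_twelve_eq_one_of_valuation_j_le_one (W : WeierstrassCurve ℚ)
    [W.IsElliptic] {m : ℕ} [NeZero m] {P : geomPoints W} (hP : addOrderOf P = m)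
    {r : absoluteGaloisGroup ℚ →* (ZMod m)ˣ}
    (hr : ∀ σ : absoluteGaloisGroup ℚ, σ • P = ((r σ : (ZMod m)ˣ) : ZMod m).val • P)
    {v : HeightOneSpectrum (𝓞 ℚ)} (h3 : (3 : 𝓞 ℚ) ∉ v.asIdeal) (hmv : (m : 𝓞 ℚ) ∉ v.asIdeal)
    (hj : v.valuation ℚ W.j ≤ 1)
    {𝔓 : Ideal (absIntegers (𝓞 ℚ) ℚ)} (h𝔓 : 𝔓 ∈ v.primesAbove)
    {τ : absoluteGaloisGroup ℚ} (hτ : τ ∈ 𝔓.inertia (absoluteGaloisGroup ℚ)) :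
    r τ ^ 12 = 1 := by
  have hmP : m • P = 0 := by rw [← hP]; exact addOrderOf_nsmul_eq_zero P
  have h12 : τ ^ 12 • P = P :=
    Mazur1978.pow_twelve_smul_eq_of_mem_inertia_of_valuation_j_le_one_of_three W h3 hj h𝔓 hτ hmv hmP
  have h' : ((r (τ ^ 12) : (ZMod m)ˣ) : ZMod m).val • P = P := by rw [← hr]; exact h12
  have h1 : ((r (τ ^ 12) : (ZMod m)ˣ) : ZMod m) = 1 :=
    Mazur1978.eq_one_of_val_smul_eq_of_addOrderOf W hP h'
  rw [map_pow] at h1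
  exact Units.val_eq_one.mp h1

/-- T2 (one cycle): `v(j) < 0` at a place `v ∤ ℓ` (e.g. `v = 2`) ⇒ `r̄(τ)² = 1` on inertia at `v`.
Proof: a quadratic twist `W^{(d)}` is multiplicative at `v`
(`exists_hasMultiplicativeReductionAt_quadraticTwist_of_one_lt_valuation_j`); the signed
equivariant `f : W^{(d)}(ℚ̄) ≃+ W(ℚ̄)` (`exists_addEquiv_geomPoints_quadraticTwist_signed`) carries
`P` to a point `P'` of order `ℓᵏ` on which `τ` acts by `±(r τ).val`; U2's argument on `W^{(d)}`
gives `±r̄(τ) = 1`.  (Prime-level pattern: `Mazur1978.isogenyCharacter_sq_eq_one_of_one_lt_valuation_j`.) -/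
theorem unitsMap_cyclicCharacter_sq_eq_one_of_one_lt_valuation_j (W : WeierstrassCurve ℚ)
    [W.IsElliptic] {v : HeightOneSpectrum (𝓞 ℚ)} (hj : 1 < v.valuation ℚ W.j)
    {ℓ k : ℕ} [Fact ℓ.Prime] (hℓv : (ℓ : 𝓞 ℚ) ∉ v.asIdeal) (hk : 1 ≤ k)
    {P : geomPoints W} (hP : addOrderOf P = ℓ ^ k)
    {r : absoluteGaloisGroup ℚ →* (ZMod (ℓ ^ k))ˣ}
    (hr : ∀ σ : absoluteGaloisGroup ℚ, σ • P = ((r σ : (ZMod (ℓ ^ k))ˣ) : ZMod (ℓ ^ k)).val • P)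
    {𝔓 : Ideal (absIntegers (𝓞 ℚ) ℚ)} (h𝔓 : 𝔓 ∈ v.primesAbove)
    {τ : absoluteGaloisGroup ℚ} (hτ : τ ∈ 𝔓.inertia (absoluteGaloisGroup ℚ)) :
    ZMod.unitsMap (pow_halfCeil_dvd ℓ k) (r τ) ^ 2 = 1 := by
  sorry

/-! ## D — the place `ℓ`: filtration dichotomy on ONE line (replaces gen-2 L2a/L2b bases + A3) -/

/-- D1 (pure algebra, one cycle; brute-force checkable over `ℤ/9, ℤ/25, ℤ/27`): a subgroup `E₁`
("kernel of reduction" / "torus") on which each `τ i` acts by `x i` and modulo which it acts by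
`y i`; if one `x i₀ − y i₀` is prime to `ℓ`, a `τ`-stable cyclic line `ℤP` of order `ℓᵏ` with
scalars `lam i` has EITHER all `lam i ≡ y i` OR all `lam i ≡ x i (mod ℓᵏ)`.
(Let `ℓ^μ` generate `{c : cP ∈ E₁}`; `(lam−y)P ∈ E₁ ⇒ ℓ^μ ∣ lam − y`; `τ(ℓ^μP) = x·ℓ^μP ⇒
ℓ^{k−μ} ∣ lam − x`; `0 < μ < k` would give `ℓ ∣ x i₀ − y i₀`.) -/
theorem filtration_dichotomy {M : Type*} [AddCommGroup M] {ℓ k : ℕ} (hℓ : ℓ.Prime)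
    (E₁ : AddSubgroup M) {ι : Type*} (τ : ι → M →+ M) (x y : ι → ℤ)
    (hx : ∀ i, ∀ Q ∈ E₁, ℓ ^ k • Q = 0 → τ i Q = x i • Q)
    (hy : ∀ i (Q : M), ℓ ^ k • Q = 0 → τ i Q - y i • Q ∈ E₁)
    (i₀ : ι) (hi₀ : ¬ ((ℓ : ℤ) ∣ x i₀ - y i₀))
    {P : M} (hP : addOrderOf P = ℓ ^ k) (lam : ι → ℤ) (hlam : ∀ i, τ i P = lam i • P) :
    (∀ i, (ℓ : ℤ) ^ k ∣ lam i - y i) ∨ (∀ i, (ℓ : ℤ) ^ k ∣ lam i - x i) := by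
  sorry

/-- D2 (transport, M; both inputs PROVED in the tree): at a good ORDINARY `v ∣ ℓ` there is a
subgroup `E₁ ≤ W(ℚ̄)` (preimage of `W.localKernelOfReduction v` under `pointsMapOfEmb … (closureEmb …)`,
after arranging `𝔓 = 𝔓_{ι,𝔐}` as in the proof of `smul_smul_sub_eq_of_mem_inertia_geomPoints`) with:
inertia acts on `E₁[ℓᵏ]` through `χ_{ℓᵏ}` (`ordinaryReduction_inertia_smul_of_mem_kernelReduction_holds`,
plus `toZModPow k ∘ cyclotomicCharacter K_v ℓ ∘ res = modNCyclotomicCharacter ℚ (ℓᵏ)`), and trivially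
modulo `E₁` on `W[ℓᵏ]` (`ordinaryReduction_exists_unramified_character_mod_kernelReduction_holds`, `φ = 1`
on inertia). -/
theorem exists_ordinaryFiltration (W : WeierstrassCurve ℚ) [W.IsElliptic]
    {v : HeightOneSpectrum (𝓞 ℚ)} (hgood : W.HasGoodReductionAt v) {ℓ : ℕ} [Fact ℓ.Prime]
    (hℓv : (ℓ : 𝓞 ℚ) ∈ v.asIdeal) (hord : ¬ ((ℓ : ℤ) ∣ W.frobeniusTraceAt v)) (k : ℕ)
    {𝔓 : Ideal (absIntegers (𝓞 ℚ) ℚ)} (h𝔓 : 𝔓 ∈ v.primesAbove) :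
    ∃ E₁ : AddSubgroup (geomPoints W),
      (∀ τ ∈ 𝔓.inertia (absoluteGaloisGroup ℚ), ∀ Q ∈ E₁, ℓ ^ k • Q = 0 →
        τ • Q = ((((modNCyclotomicCharacter ℚ (ℓ ^ k) τ : (ZMod (ℓ ^ k))ˣ) :
          ZMod (ℓ ^ k)).val : ℤ)) • Q) ∧
      (∀ τ ∈ 𝔓.inertia (absoluteGaloisGroup ℚ), ∀ Q : geomPoints W, ℓ ^ k • Q = 0 →
        τ • Q - Q ∈ E₁) := by
  sorry

/-- D3 (transport, M/L — the HARDEST helper; input PROVED in the tree): at a MULTIPLICATIVE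
`v ∣ ℓ` (`ℓ` odd) there are a subgroup `E₁ ≤ W(ℚ̄)` (the transported toric torsion `Ψ(μ_{ℓᵏ})` of
`Silverman1994_thmV53_corV54_tateUniformisation_holds`) and signs `s τ = ±1` (the twist character)
with: inertia acts on `E₁[ℓᵏ]` by `s·χ_{ℓᵏ}`, and by `s` modulo `E₁` on `W[ℓᵏ]`
(`τΨ(u) − sΨ(u) = sΨ(τu/u)`, `τu/u ∈ μ_{ℓᵏ}` since `q ∈ ℚ_v`).  Only these two relations are
needed — no basis, and `s = 1` on inertia is NOT needed. -/
theorem exists_multiplicativeFiltration (W : WeierstrassCurve ℚ) [W.IsElliptic]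
    {v : HeightOneSpectrum (𝓞 ℚ)} (hv : W.HasMultiplicativeReductionAt v) {ℓ : ℕ} [Fact ℓ.Prime]
    (hℓ2 : ℓ ≠ 2) (hℓv : (ℓ : 𝓞 ℚ) ∈ v.asIdeal) (k : ℕ)
    {𝔓 : Ideal (absIntegers (𝓞 ℚ) ℚ)} (h𝔓 : 𝔓 ∈ v.primesAbove) :
    ∃ (E₁ : AddSubgroup (geomPoints W)) (s : absoluteGaloisGroup ℚ → ℤ),
      (∀ τ, s τ = 1 ∨ s τ = -1) ∧
      (∀ τ ∈ 𝔓.inertia (absoluteGaloisGroup ℚ), ∀ Q ∈ E₁, ℓ ^ k • Q = 0 →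
        τ • Q = (s τ * ((((modNCyclotomicCharacter ℚ (ℓ ^ k) τ : (ZMod (ℓ ^ k))ˣ) :
          ZMod (ℓ ^ k)).val : ℤ))) • Q) ∧
      (∀ τ ∈ 𝔓.inertia (absoluteGaloisGroup ℚ), ∀ Q : geomPoints W, ℓ ^ k • Q = 0 →
        τ • Q - s τ • Q ∈ E₁) := by
  sorry

/-- D5 (assembly at `ℓ`, S): for `W` semistable at the odd prime `ℓ` and a stable cyclic line of
order `ℓᵏ`, there is ONE `ε ∈ {0,1}` with `(r(τ)·χ_{ℓᵏ}(τ)^{-ε})² = 1` for all `τ` in inertia at `ℓ`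
(`= 1` in the ordinary case).  Cases: good ordinary — D2 + D1 (`y = 1`, `x = χ`); multiplicative —
D3 + D1 (`y = s`, `x = sχ`); good supersingular — impossible for `k ≥ 1` (gen-2 k2 L2c
`not_dvd_frobeniusTrace_of_stableLine` on `ℓ^{k−1}P`).  The witness `i₀ = τ₀` with
`χ_{ℓᵏ}(τ₀) ≢ 1 (mod ℓ)` is `exists_mem_inertia_modNCyclotomicCharacter_eq` (`d = 1`, `a = 2`, `ℓ ≥ 3`). -/
theorem exists_cyclicCharacter_sq_eq_at_ell_of_line (W : WeierstrassCurve ℚ) [W.IsElliptic]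
    [W.IsGloballyMinimal] (ℓ k : ℕ) [Fact ℓ.Prime] (hℓ2 : ℓ ≠ 2) (hk : 1 ≤ k)
    {v : HeightOneSpectrum (𝓞 ℚ)} (hℓv : (ℓ : 𝓞 ℚ) ∈ v.asIdeal) (hss : W.IsSemistableAt v)
    {P : geomPoints W} (hP : addOrderOf P = ℓ ^ k)
    {r : absoluteGaloisGroup ℚ →* (ZMod (ℓ ^ k))ˣ}
    (hr : ∀ σ : absoluteGaloisGroup ℚ, σ • P = ((r σ : (ZMod (ℓ ^ k))ˣ) : ZMod (ℓ ^ k)).val • P) :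
    ∃ ε : ℕ, (ε = 0 ∨ ε = 1) ∧ ∀ 𝔓 ∈ v.primesAbove, ∀ τ ∈ 𝔓.inertia (absoluteGaloisGroup ℚ),
      (r τ * (modNCyclotomicCharacter ℚ (ℓ ^ k) τ ^ ε)⁻¹) ^ 2 = 1 := by
  sorry

/-! ## G1 — Minkowski normal form at HALF level -/

/-- G1 (S, pattern = `Mazur1978.exists_forall_eq_mul_modNCyclotomicCharacter_pow`): for `W`
globally minimal and semistable away from `2`, `ℓ` odd, the reduction `r̄` of the character of a
stable cyclic line of order `ℓᵏ` is `b·χ^ε` with `b¹² = 1`: `ψ := (r̄·χ̄^{-ε})¹²` is trivial on every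
inertia group (good `v ∤ 2ℓ`: `Mazur1978.cyclicCharacter_eq_one_of_mem_inertia` +
`modNCyclotomicCharacter_eq_one_of_mem_inertia`; multiplicative `v ∤ 2ℓ`: U2; `v = 2`: T1/T2 by
`v.valuation ℚ W.j ≤ 1` or not; `v = ℓ`: D5), `ker ψ ⊇ stab(P) ∩ ker χ` is open
(`isOpen_stabilizer_point_holds`), so `ψ = 1` by `Mazur1978.monoidHom_eq_one_of_forall_inertia`. -/
theorem exists_unitsMap_cyclicCharacter_normalForm (W : WeierstrassCurve ℚ) [W.IsElliptic]
    [W.IsGloballyMinimal] (ℓ k : ℕ) [Fact ℓ.Prime] (hℓ2 : ℓ ≠ 2) (hk : 1 ≤ k)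
    (hss : ∀ v : HeightOneSpectrum (𝓞 ℚ), (2 : 𝓞 ℚ) ∉ v.asIdeal → W.IsSemistableAt v)
    {P : geomPoints W} (hP : addOrderOf P = ℓ ^ k)
    {r : absoluteGaloisGroup ℚ →* (ZMod (ℓ ^ k))ˣ}
    (hr : ∀ σ : absoluteGaloisGroup ℚ, σ • P = ((r σ : (ZMod (ℓ ^ k))ˣ) : ZMod (ℓ ^ k)).val • P) :
    ∃ ε : ℕ, (ε = 0 ∨ ε = 1) ∧ ∀ σ : absoluteGaloisGroup ℚ,
      ZMod.unitsMap (pow_halfCeil_dvd ℓ k)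
        (r σ * (modNCyclotomicCharacter ℚ (ℓ ^ k) σ ^ ε)⁻¹) ^ 12 = 1 := by
  sorry

/-! ## H5 — the half-level Frobenius divisibility (the line's output), and the counting end -/

/-- `n₁₂(p) = p¹² + 1 − s₁₂(a_p, p) = #E(𝔽_{p¹²})` (as an integer). -/
noncomputable def frobNorm (W : WeierstrassCurve ℚ) [W.IsGloballyMinimal] (p : ℕ) : ℤ :=
  (p : ℤ) ^ 12 + 1 - Mazur1978.frobTracePow (W.frobeniusTrace p) p 12

/-- H5 (S assembly): G0 (`exists_cyclicCharacter_of_addOrderOf`) gives `r`; G1 gives `r̄ = b·χ̄^ε`;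
at an arithmetic Frobenius `φ` above the good `p ∤ 2ℓ`,
`Mazur1978.cyclicCharacter_sq_sub_frobeniusTrace_mul_add_eq_zero` (cast down `ZMod (ℓᵏ) → ZMod (ℓ^⌈k/2⌉)`)
makes `t := r̄(φ)` a root of `X² − a_pX + p`, `χ(φ) = p`, so `t = b·p^ε`, and gen-2 k2's A1
`natCast_dvd_frobNorm_of_root` (with `n = ℓ^⌈k/2⌉`) concludes. -/
theorem pow_halfCeil_dvd_frobNorm_of_stableLine (W₁ : WeierstrassCurve ℚ) [W₁.IsElliptic]
    [W₁.IsGloballyMinimal] (ℓ k : ℕ) [Fact ℓ.Prime] (hℓ2 : ℓ ≠ 2)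
    (hss : ∀ v : HeightOneSpectrum (𝓞 ℚ), (2 : 𝓞 ℚ) ∉ v.asIdeal → W₁.IsSemistableAt v)
    {P : geomPoints W₁} (hP : addOrderOf P = ℓ ^ k)
    (hst : ∀ σ : absoluteGaloisGroup ℚ, σ • P ∈ AddSubgroup.zmultiples P)
    (p : ℕ) [Fact p.Prime] (hp2 : p ≠ 2) (hpℓ : p ≠ ℓ) (hgood : W₁.HasGoodReductionAtPrime p) :
    (ℓ : ℤ) ^ halfCeil k ∣ frobNorm W₁ p := by
  sorry

/-- G0 (XS glue): the `ℓ`-primary part of the (cyclic, `Γ_ℚ`-stable) kernel of a cyclic isogeny is a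
stable cyclic line of order `ℓ^{v_ℓ(deg)}` (characteristic subgroup of a stable subgroup). -/
theorem exists_stableLine_of_isCyclic {W₁ W₂ : WeierstrassCurve ℚ} [W₁.IsElliptic] [W₂.IsElliptic]
    (φ : Isogeny W₁ W₂) (hφ : φ.IsCyclic) (ℓ k : ℕ) [Fact ℓ.Prime] (hdiv : ℓ ^ k ∣ φ.degree) :
    ∃ P : geomPoints W₁, addOrderOf P = ℓ ^ k ∧
      ∀ σ : absoluteGaloisGroup ℚ, σ • P ∈ AddSubgroup.zmultiples P := by
  sorry

/-- C1 (counting end, PROVED): half exponents at every prime give `d ∣ n²` (vs gen-2's `d ∣ n³`). -/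
theorem dvd_sq_of_forall_pow_halfCeil_dvd {d n : ℕ} (hd : 0 < d) (hn : 0 < n)
    (h : ∀ ℓ : ℕ, ℓ.Prime → ℓ ∣ d → ℓ ^ halfCeil (d.factorization ℓ) ∣ n) : d ∣ n ^ 2 := by
  rw [← Nat.factorization_le_iff_dvd hd.ne' (pow_pos hn 2).ne', Nat.factorization_pow]
  refine Finsupp.le_def.mpr fun ℓ => ?_
  rw [Finsupp.smul_apply, smul_eq_mul]
  by_cases hℓ : ℓ.Prime
  · by_cases hℓd : ℓ ∣ d
    · have h2 : halfCeil (d.factorization ℓ) ≤ n.factorization ℓ :=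
        (hℓ.pow_dvd_iff_le_factorization hn.ne').mp (h ℓ hℓ hℓd)
      have h3 := le_two_mul_halfCeil (d.factorization ℓ)
      omega
    · rw [Nat.factorization_eq_zero_of_not_dvd hℓd]; exact Nat.zero_le _
  · rw [Nat.factorization_eq_zero_of_not_prime d hℓ]; exact Nat.zero_le _

/-- C0 (the typed output of the line, Mazur–Kenku-free): for `W₁` globally minimal and semistable
away from `2`, a cyclic isogeny out of `W₁` has degree dividing `16·(n₁₂(p₀)·n₁₂(p₁))²` for any two
distinct odd good primes.  From G0 + H5 (at the `pᵢ ≠ ℓ`) + C1 for the odd part, and the landed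
`Summit.ABC.ABC.Theorems.isogeny_isCyclic_degree_ne_thirtyTwo` (+ `Isogeny.exists_isCyclic_degree_eq_of_dvd`)
for the `2`-part. -/
def CyclicDegreeDvdFrobNormSq : Prop :=
  ∀ (W₁ W₂ : WeierstrassCurve ℚ) [W₁.IsElliptic] [W₂.IsElliptic] [W₁.IsGloballyMinimal],
    (∀ v : HeightOneSpectrum (𝓞 ℚ), (2 : 𝓞 ℚ) ∉ v.asIdeal → W₁.IsSemistableAt v) →
    ∀ (φ : Isogeny W₁ W₂), φ.IsCyclic →
    ∀ (p₀ p₁ : ℕ) [Fact p₀.Prime] [Fact p₁.Prime], p₀ ≠ 2 → p₁ ≠ 2 → p₀ ≠ p₁ →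
      W₁.HasGoodReductionAtPrime p₀ → W₁.HasGoodReductionAtPrime p₁ →
      φ.degree ∣ 16 * ((frobNorm W₁ p₀ * frobNorm W₁ p₁).natAbs) ^ 2

theorem cyclicDegreeDvdFrobNormSq : CyclicDegreeDvdFrobNormSq := by
  sorry

/-- k1's replacement input, verbatim (`…Sketch.Ideas1.FreyIsogenyDiameter`; restated because the
`Cruxes/` modules are not built on the farm). -/
def FreyIsogenyDiameter : Prop :=
  ∀ ε : ℝ, 0 < ε → ∃ C : ℝ, ∀ a b : ℤ, IsCoprime a b → a * b * (a + b) ≠ 0 →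
    ∀ (W₁ W₂ : WeierstrassCurve ℚ) [W₁.IsElliptic] [W₂.IsElliptic],
      (freyCurve a b).IsIsogenous W₁ → (freyCurve a b).IsIsogenous W₂ →
      ∀ φ : Isogeny W₁ W₂, φ.IsCyclic →
        (φ.degree : ℝ) ≤ C * (((freyCurve a b).conductorNorm ℤ : ℕ) : ℝ) ^ ε

/-- ASSEMBLY (S): C0 at a globally minimal model of `W₁` (degree is model-independent), which is
semistable away from `2` (the Frey curve is; isogeny invariance `hasMultiplicativeReductionAt_of_isIsogenous`
/ good reduction), with k1 H7 (`0 < n₁₂(p) ≤ (p⁶+1)²`, Hasse) and k1 H8 (two odd good primes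
`≪_δ N^δ`, Bertrand), `δ = ε/48`.  Then k1's `definiteRTControlPrime_of_diameter (hT) (hDiam)`
closes the crux with `C = 4·C(ε/2)²` in place of `4·163²`. -/
theorem freyIsogenyDiameter_of_halfLevel (h0 : CyclicDegreeDvdFrobNormSq) : FreyIsogenyDiameter := by
  sorry

end Summit.ABC.ABC.Cruxes.DefiniteRTControlPrime.Sketch.Ideas2g3
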